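/-
Copyright (c) 2026 the pub-hodgecm-mathlib formalisation cell (harness21).  Prover seat hodgecm-mathlib-LH4-p05 (g8), Track A «(D-RAM) FOUR-FRAME» squad, helper lane on
h413 = stmt-HodgeConjecture-24833 (count-neutral).  Heir dealer∕pen LH4-plan (g13) WORD #58 RULING B (i) (second half): THE REDUCTION BRICK of the DERIVED T₊ road (directive
D-1b §4, ED. 6); statements = (L-T+)-SIG v5 ∕ scratch v8 5bf8a2d172f1b186 §3–§4 (boxes LH4-r01 LM∕LR, REF5 R5-269∕R5-274) over ★ DEFS LEAF №6.  2026-09-04.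
-/
import Summits.HodgeConjecture.HodgeConjecture.Theorems.F0P3cDyRamStageOneBDerivedDefs         -- ★-to-be p859675 DEFS LEAF №6 «STAGE-1b DERIVED (T₊)» (this seat): `amplShift`, `amplHalfDiff`, `amplTransvPlusDerived`, `n0DerivedOfRecord`, (α′) `LabelPlusCleanLawAt`, (β) `CleanSgnFrameConstLawAt`, `TransvPlusKappaSignLawAtS2`, `TransvPlusLawTarget(Derived)`; brings ★ p859562 №5
import Summits.HodgeConjecture.HodgeConjecture.Theorems.F0P3cDyRamOmegaRDefs                     -- ★ `omegaR`; brings ★ №1-R2 `OmegaSchedule`, `KappaSignLawAtS2`, ★ №1-R `shiftR`, ★ №1 `DyadicFence`, `depthOfRecord`, ★ #0a tokens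
import Summits.HodgeConjecture.HodgeConjecture.Theorems.F0P3cDyRamFrameEltLevelAlgebra            -- ★ p858722: `transvPlusFixCount_add_transvMinusFixCount`; brings ★ census DEFS (`transvPlusFixCount`, `LatticeInLevel`, `cntStar`), ★ №3 `mstarOfRecord`
import Summits.HodgeConjecture.HodgeConjecture.Theorems.F0P3cDyRamLevelsPieceCountDictionary      -- ★ p858704: §3 bridge `ncard_shell_add_ncard_levels_succ_eq_ncard_levels`; brings ★ `pieceCountDictionary_transvPlus` (U2G profiles dictionary)
import Summits.HodgeConjecture.HodgeConjecture.Theorems.F0P3cDyRamPieceRowsOfFrameSignedCensus    -- ★ p858837 (LH4-p11 (g7)): THE (J) SOCKET IN FRAME CURRENCY `pieceRowsWild_gselStar_of_frameSignedCensus`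
import Summits.HodgeConjecture.HodgeConjecture.Theorems.F0P3cDyRamFourFrameLawsDeepThreshold      -- ★ p857235: `fourFrameTransferFactorS_any` ((D-CΔ)-S at every schedule)
import Summits.HodgeConjecture.HodgeConjecture.Theorems.F0P3cDyRamDOfPlaceOfDatum                 -- ★ `dOfPlace_eq_of_isRamifiedQuadraticDatum`
import Summits.HodgeConjecture.HodgeConjecture.Theorems.F0P3cDyRamPieceRowsWildUnit0OfExports     -- ★ p857318: `v_two_lt_one_of_not_isUnit_two` (the dyadic fence at a wild place)
import Literature.NumberTheory.Automorphic.AdicCompletionIntegerSpellings                          -- ★ `isUnit_two_valuationInteger_of_isUnit_two`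
import Literature.NumberTheory.Automorphic.UnitaryThreeFourFrameFixedFinite                         -- ★ `finite_setOf_latticeGraphIso_eq_of_frameElt` (fixed vertices of a frame literal are finite); brings ★ `exists_unitary_coe_eq_smul_frameElt`
import HarnessLib

/-!
# Crux `H413`, line LH4 «(D-RAM) FOUR-FRAME» — THE DERIVED T₊ LAW FROM THE CLEAN LEVEL LAWS: `TransvPlusLawTargetDerived N₀T ⟸ (T4) ∧ (T5) ∧ (α′) ∧ (β)`, sorry-free, and the
# (J) junction at `j = 1` that carries it to the tier-0 row type `PieceRowsWild gselStar 1`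

Cell `hodgecm-mathlib` (D-0151), FLOOR 0, crux item H413 = `stmt-HodgeConjecture-24833`, route `HCCMUnconditional`; squad F0∕P3c∕LH4.  THEOREMS ONLY (no `def`, no instance, no
notation, no `sorry`, default heartbeats); lane `--supports stmt-HodgeConjecture-24833 --as helper`; pays NO row, states NO law (every census Prop enters as a HYPOTHESIS).

WHY (heir LEAD F0P3a-plan (g20) T19-31 (R-29)(b) «T₊ DERIVED», T19-32 «no primary (L-T+) letter; p05's derived road = typed vehicle of record», D-1b §4; F0P3-p01 (g35) TEMPLATE-LAWS
0e5ec958 §2–§3; digits LH4-r01 BOX LQ 27∕27, signs REF5 R5-274).  In ★ DEFS LEAF №6's vocabulary: on a type-(1) four-frame literal `Γ_b` the fixed type-0 vertices on the CLEAN shell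
`shellFixCount (ℓ₀, m_c)` split as `T+ ⊔ T−′` (`transvPlusFixCount (ℓ₀, m*)` ⊔ `cleanMinusFixCount (ℓ₀, m*, m_c)`) as soon as (α′) «LabelPlus on the shell ⇒ `X²·M ⊆ ϖ^{m_c}M`» holds at
that literal (§2 `transvPlusFixCount_add_cleanMinusFixCount_eq`; finiteness of the fixed set is DERIVED, §1 `finite_fixed_typeZero_frameElt`, from ★ `finite_setOf_latticeGraphIso_eq_of_frameElt`);
(β) «`T+ − T−′` frame-constant» and `Σ_b κ_i(b) = 0` give `2·Σ_b κ_i(b)·T+(Γ_b) = Σ_b κ_i(b)·shell(ℓ₀, m_c)(Γ_b)` (§2 `two_mul_kappaSum_transvPlusFixCount_eq_clean`); the clean shell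
is `lev_{ℓ₀,m_c} − lev_{ℓ₀+1,m_c}` (★ p858704 §3 bridge, §1), so two instances of ★ №5's `LevKappaSignLawAtS2` at square level `m_c` with a common sign token `S` give
`Σ κ·T+ = S·(A − A′)∕2` — i.e. `TransvPlusKappaSignLawAtS2 shift Ω N₀ (amplHalfDiff (amplShift k₁ b₁) (amplShift k₂ b₂))` (§3, schedule-generic, needs only `m* ≤ mc d`), and at the
letters of record `TransvPlusLawTargetDerived N₀T` from the four fenced ∀-closures (HEAD `transvPlusLawTargetDerived_of`; thresholds weakened by antitonicity, §1).  §4 reads the law AT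
THE (J) SOCKET: `cntStar 1 = transvPlusFixCount σ_w ϖ d (d % 2) (mstarOfRecord d)` after ★ `dOfPlace_eq_of_isRamifiedQuadraticDatum`, the `ℤ → ℚ → ℂ` casts by `push_cast`, and
`pieceRowsWild_gselStar_one_of_law_of_hside shift Ω N₀ A (hL : ∀ datum, DyadicFence (TransvPlusKappaSignLawAtS2 …)) (hH : (H-T+)′) : PieceRowsWild gselStar 1` (★ p858837 at `j := 1`,
fence discharged at the wild place; the twin of LH4-p14 (g6)'s ★ p859064 from the law side) — so `TransvPlusLawTargetDerived` + an (H-T+)′ triple at `A := amplTransvPlusDerived`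
reach `stub_rows_transvPlus`'s type BY NAME.
WHAT IS PROVED (all TRIO): §1 `sum_kappaChar_eq_zero`, `finite_fixed_typeZero_frameElt`, `shellFixCount_eq_transvPlus_add_transvMinus`, `shellFixCount_eq_sub`,
`kappaSum_shellFixCount_eq_of_low_of_high`, `shellKappaSignLawAtS2_of_low_of_high`, `levKappaSignLawAtS2_of_le`, `transvPlusKappaSignLawAtS2_of_le`; §2 `latticeInLevel_of_le`,
`transvPlusFixCount_add_cleanMinusFixCount_eq`, `two_mul_transvPlusFixCount_eq_clean`, `two_mul_kappaSum_transvPlusFixCount_eq_clean`; §3 `transvPlusKappaSignLawAtS2_of_levClean_of_labelClean_of_cleanSgn`,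
HEAD **`transvPlusLawTargetDerived_of`**; §4 `gselStar_one`, `cntStar_one`, `pieceCountDictionary_gselStar_one`, `cntStar_one_apply_eq`, `sum_kappaChar_mul_cntStar_one_eq`,
`pieceRowsWild_gselStar_one_of_law_of_hside`.
HONEST LABEL.  Count-neutral; every law ∕ label ∕ H-side statement is a HYPOTHESIS here ((T4)(T5) = F0P3a-p01's targets, (α′) = LH4-p13's (L-lab-14), (β) = this seat's next target,
(H-T+)′ = LH4-p14's); the tier-0 row `stub_rows_transvPlus` and the six ED. 5 letters stay OPEN; `HC_CM` is proved only modulo the 7 printed citations (2 remaining named inputs: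
hLiu418 = `stmt-HodgeConjecture-24832`, h413 = `stmt-HodgeConjecture-24833`) until rung 0 closes.

## References
* [Rogawski1990] J. D. Rogawski, *Automorphic Representations of Unitary Groups in Three Variables*, Ann. of Math. Stud. 123 (1990): §4.9 Prop. 4.9.1 (a)(b) p. 55, Lemma 4.9.3 p. 56; §8.1 Prop. 8.1.2 (b) p. 113.
* [LanglandsShelstad1987] R. P. Langlands, D. Shelstad, *On the definition of transfer factors*, Math. Ann. 278 (1987), §1.3, §3.
* [Kottwitz1986BaseChangeUnits] R. E. Kottwitz, *Base change for unit elements of Hecke algebras*, Compositio Math. 60 (1986), §1 pp. 240–241.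
-/

set_option autoImplicit false

noncomputable section

namespace Summit.HodgeConjecture.HodgeConjecture.Cruxes.H413.F0P3cDyRamTransvPlusLawOfCleanLevels

open MeasureTheory Measure NumberField IsDedekindDomain Topology Filter
open Literature.NumberTheory.Automorphic Literature.NumberTheory.Automorphic.UnitaryGroup Literature.NumberTheory.Automorphic.IntegralReduction
open Literature.NumberTheory.Automorphic.UnitaryLatticeTree Literature.NumberTheory.Automorphic.HermitianLattice
open Literature.NumberTheory.Rogawski1990 Literature.NumberTheory.GaloisRepresentations
open Literature.NumberTheory.Automorphic.UnitaryThreeFourFrame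
open scoped Matrix MatrixGroups Classical ValuativeRel WithZero
open Summit.HodgeConjecture.HodgeConjecture.Cruxes.H413.F0P3cDyRamFourFrameLawDefs
open Summit.HodgeConjecture.HodgeConjecture.Cruxes.H413.F0P3cDyRamFourFrameLawDefsR
open Summit.HodgeConjecture.HodgeConjecture.Cruxes.H413.F0P3cDyRamFourFrameLawDefsR2
open Summit.HodgeConjecture.HodgeConjecture.Cruxes.H413.F0P3cDyRamOmegaRDefs
open Summit.HodgeConjecture.HodgeConjecture.Cruxes.H413.F0P3cDyRamFourFrameHSideDefsR
open Summit.HodgeConjecture.HodgeConjecture.Cruxes.H413.F0P3cDyRamFourFramePieces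
open Summit.HodgeConjecture.HodgeConjecture.Cruxes.H413.F0P3cDyRamFourFrameCensusDefs
open Summit.HodgeConjecture.HodgeConjecture.Cruxes.H413.F0P3cDyRamFrameEltLevelAlgebra
open Summit.HodgeConjecture.HodgeConjecture.Cruxes.H413.F0P3cDyRamLevelsPieceCountDictionary
open Summit.HodgeConjecture.HodgeConjecture.Cruxes.H413.F0P3cDyRamPieceCountDictionaryProfiles
open Summit.HodgeConjecture.HodgeConjecture.Cruxes.H413.F0P3cDyRamPieceRowsOfFrameSignedCensus
open Summit.HodgeConjecture.HodgeConjecture.Cruxes.H413.F0P3cDyRamFourFrameLawsDeepThreshold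
open Summit.HodgeConjecture.HodgeConjecture.Cruxes.H413.F0P3cDyRamDOfPlaceOfDatum
open Summit.HodgeConjecture.HodgeConjecture.Cruxes.H413.F0P3cDyRamPieceRowsWildUnit0OfExports
open Summit.HodgeConjecture.HodgeConjecture.Cruxes.H413.F0P3cDyRamStageOneBDefs
open Summit.HodgeConjecture.HodgeConjecture.Cruxes.H413.F0P3cDyRamStageOneBDerivedDefs

/-! ## §1  Bookkeeping over ★ DEFS №5∕№6: `Σ_b κ_i(b) = 0`; finiteness of the frame literals' fixed sets; the unlabelled shell = lower − upper two-level census; threshold weakeners -/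

section Reduction

variable {K : Type} [Field K] [Valued K ℤᵐ⁰]

/-- `Σ_b κ_i(b) = 0` — each `κ_i` is a non-trivial character of `(ℤ∕2)²`. [cite: Rogawski1990, §4.9 Prop. 4.9.1 (a) p. 55] -/
theorem sum_kappaChar_eq_zero (i : Fin 3) : (∑ b : Fin 4, kappaChar i b) = 0 := by
  fin_cases i <;> simp [kappaChar, signPair, Fin.sum_univ_four]

/-- **FINITENESS OF THE FIXED TYPE-0 VERTEX SET OF A FRAME LITERAL** at a ramified datum and a (regular) element datum: ★ `finite_setOf_latticeGraphIso_eq_of_frameElt` (graph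
vertices) transported to the census set-builder, ★ `exists_unitary_coe_eq_smul_frameElt` (at `z = 1`) making `Γ_b` a unitary element — discharges the `hfin` of every datum-level
reduction (LH4-r01 (g7) 09:35:14Z: a global `∀ T` finiteness hypothesis is unsatisfiable, `T = 1` fixes the whole infinite tree). [cite: Rogawski1990, §4.9 Prop. 4.9.1 (a) p. 55] -/
theorem finite_fixed_typeZero_frameElt [Fintype (Valued.ResidueField K)] {σ : K →+* K} {ϖ : K} {d t : ℕ} (hD : IsRamifiedQuadraticDatum σ ϖ d t)
    {f : Fin 4 → Fin 3 → (Fin 3 → K)} (hf : IsFourFrameFamily σ f) {α β : K} {N₀ n₁ n₂ n₃ : ℕ} (hE : IsElementDatum σ ϖ N₀ α β n₁ n₂ n₃)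
    {Γ : Fin 4 → GL (Fin 3) K} (hΓ : ∀ b', (Γ b' : Matrix (Fin 3) (Fin 3) K) = frameElt σ f b' α β) (b' : Fin 4) :
    {M : Submodule (Valued.integer K) (Fin 3 → K) | IsVertexLattice σ ϖ ((StdForm.antidiagonal 3).over K) 0 M ∧ mapGL (Γ b') M = M}.Finite := by
  obtain ⟨hσσ, hvσ, hvϖ, heven, -, -, -⟩ := hD
  obtain ⟨hα, hβ, hαβ, hα1, hβ1, -⟩ := hE
  obtain ⟨U, hU, hUe⟩ := exists_unitary_coe_eq_smul_frameElt hf b' (z := (1 : K))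
    (by rw [mul_comm]; exact hα) (by rw [mul_comm]; exact hβ) (by rw [map_one, mul_one])
  rw [one_smul] at hUe
  have hfin := finite_setOf_latticeGraphIso_eq_of_frameElt hσσ hvσ hvϖ heven hf b' hα hβ hαβ hα1 hβ1 ⟨U, hU⟩ hUe
  refine (hfin.image Subtype.val).subset ?_
  rintro M ⟨h0, hM⟩
  refine ⟨⟨M, ⟨0, h0⟩⟩, ?_, rfl⟩
  show latticeGraphIso σ ϖ ((StdForm.antidiagonal 3).over K) ⟨U, hU⟩ ⟨M, ⟨0, h0⟩⟩ = ⟨M, ⟨0, h0⟩⟩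
  apply Subtype.ext
  rw [latticeGraphIso_apply_coe]
  have hUΓ : (U : Matrix (Fin 3) (Fin 3) K) = (Γ b' : Matrix (Fin 3) (Fin 3) K) := hUe.trans (hΓ b').symm
  show M.map ((Matrix.toLin' (U : Matrix (Fin 3) (Fin 3) K)).restrictScalars (Valued.integer K)) = M
  rw [hUΓ]
  exact hM

/-- `shellFixCount = transvPlusFixCount + transvMinusFixCount` on a finite fixed set (★ p858722, by name; p01's `shellFixCount_eq_transvPlus_add_transvMinus`). [cite: Rogawski1990, §4.9 Prop. 4.9.1 (a) p. 55] -/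
theorem shellFixCount_eq_transvPlus_add_transvMinus (σ : K →+* K) (ϖ : K) (d ℓ m : ℕ) (T : GL (Fin 3) K)
    (hfin : {M : Submodule (Valued.integer K) (Fin 3 → K) | IsVertexLattice σ ϖ ((StdForm.antidiagonal 3).over K) 0 M ∧ mapGL T M = M}.Finite) :
    shellFixCount σ ϖ ℓ m T = transvPlusFixCount σ ϖ d ℓ m T + transvMinusFixCount σ ϖ d ℓ m T := by
  rw [shellFixCount, transvPlusFixCount_add_transvMinusFixCount σ ϖ d ℓ m T hfin]

/-- `shellFixCount ℓ m = levFixCount ℓ m − levFixCount (ℓ+1) m` in `ℤ` on a finite fixed set (★ p858704 §3 bridge). [cite: Rogawski1990, §4.9 Prop. 4.9.1 (a) p. 55] -/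
theorem shellFixCount_eq_sub (σ : K →+* K) {ϖ : K} (hϖ1 : Valued.v ϖ ≤ 1) (ℓ m : ℕ) (T : GL (Fin 3) K)
    (hfin : {M : Submodule (Valued.integer K) (Fin 3 → K) | IsVertexLattice σ ϖ ((StdForm.antidiagonal 3).over K) 0 M ∧ mapGL T M = M}.Finite) :
    (shellFixCount σ ϖ ℓ m T : ℤ) = (levFixCount σ ϖ ℓ m T : ℤ) - (levFixCount σ ϖ (ℓ + 1) m T : ℤ) := by
  have h2 := ncard_shell_add_ncard_levels_succ_eq_ncard_levels σ hϖ1 ℓ m T hfin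
  rw [eq_sub_iff_add_eq, ← Nat.cast_add, shellFixCount, levFixCount, levFixCount]
  exact congrArg Nat.cast h2

/-- The shell κ-sum from the two level κ-sums . [cite: Rogawski1990, §4.9 Prop. 4.9.1 (a) p. 55] -/
theorem kappaSum_shellFixCount_eq_of_low_of_high (σ : K →+* K) {ϖ : K} (hϖ1 : Valued.v ϖ ≤ 1) (ℓ m : ℕ) (Γ : Fin 4 → GL (Fin 3) K)
    (hfin : ∀ b, {M : Submodule (Valued.integer K) (Fin 3 → K) | IsVertexLattice σ ϖ ((StdForm.antidiagonal 3).over K) 0 M ∧ mapGL (Γ b) M = M}.Finite) (i : Fin 3)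
    (S : ℤ) (A A' : ℚ)
    (hlow : ((∑ b : Fin 4, kappaChar i b * (levFixCount σ ϖ ℓ m (Γ b) : ℤ) : ℤ) : ℚ) = (S : ℚ) * A)
    (hhigh : ((∑ b : Fin 4, kappaChar i b * (levFixCount σ ϖ (ℓ + 1) m (Γ b) : ℤ) : ℤ) : ℚ) = (S : ℚ) * A') :
    ((∑ b : Fin 4, kappaChar i b * (shellFixCount σ ϖ ℓ m (Γ b) : ℤ) : ℤ) : ℚ) = (S : ℚ) * (A - A') := by
  have h : (∑ b : Fin 4, kappaChar i b * (shellFixCount σ ϖ ℓ m (Γ b) : ℤ)) =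
      (∑ b : Fin 4, kappaChar i b * (levFixCount σ ϖ ℓ m (Γ b) : ℤ)) - ∑ b : Fin 4, kappaChar i b * (levFixCount σ ϖ (ℓ + 1) m (Γ b) : ℤ) := by
    rw [← Finset.sum_sub_distrib]
    refine Finset.sum_congr rfl fun b _ => ?_
    rw [shellFixCount_eq_sub σ hϖ1 ℓ m (Γ b) (hfin b), mul_sub]
  rw [h, Int.cast_sub, hlow, hhigh, mul_sub]

/-- (L-shell) ⇐ the two (L-lev) halves at `(laLowOfRecord, mstarOfRecord)` ∕ `(laHighOfRecord, mstarOfRecord)` (F0P3a-p01's composition at the record levels). [cite: Rogawski1990, §4.9 Prop. 4.9.1 (a) p. 55] -/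
theorem shellKappaSignLawAtS2_of_low_of_high {K : Type} [Field K] [Valued K ℤᵐ⁰] [CompleteSpace K] [Fintype (Valued.ResidueField K)]
    (shift : ℕ → ℕ → ℤ) (Ω : OmegaSchedule) (N₀ k₁ b₁ k₂ b₂ : ℕ → ℕ) (σ : K →+* K) (ϖ : K) (d t : ℕ)
    (hlow : LevKappaSignLawAtS2 shift Ω N₀ laLowOfRecord mstarOfRecord k₁ b₁ σ ϖ d t) (hhigh : LevKappaSignLawAtS2 shift Ω N₀ laHighOfRecord mstarOfRecord k₂ b₂ σ ϖ d t) :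
    ShellKappaSignLawAtS2 shift Ω N₀ laLowOfRecord mstarOfRecord k₁ b₁ k₂ b₂ σ ϖ d t := by
  intro hD f hf δ hδ hδ0 a b ha hb ha1 hb1 n₁ n₂ n₃ hE Γ hΓ k hk i B hB
  obtain ⟨-, -, hvϖ, -⟩ := id hD
  have hϖ1 : Valued.v ϖ ≤ 1 := by rw [hvϖ, ← WithZero.exp_zero, WithZero.exp_le_exp]; omega
  exact kappaSum_shellFixCount_eq_of_low_of_high σ hϖ1 (laLowOfRecord d) (mstarOfRecord d) Γ (finite_fixed_typeZero_frameElt hD hf hE hΓ) i _ _ _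
    (hlow hD f hf δ hδ hδ0 a b ha hb ha1 hb1 n₁ n₂ n₃ hE Γ hΓ k hk i B hB) (hhigh hD f hf δ hδ hδ0 a b ha hb ha1 hb1 n₁ n₂ n₃ hE Γ hΓ k hk i B hB)

/-- THRESHOLD WEAKENING · (K-SGN-lev)-S2-At is ANTITONE in `N₀` at `d` (★ `isElementDatum_of_le`) — so a neighbour's law proved at a shallower threshold feeds a reduction at the deeper common one. [cite: Rogawski1990, §4.9 Prop. 4.9.1 (a) p. 55] -/
theorem levKappaSignLawAtS2_of_le {K : Type} [Field K] [Valued K ℤᵐ⁰] [CompleteSpace K] [Fintype (Valued.ResidueField K)]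
    (shift : ℕ → ℕ → ℤ) (Ω : OmegaSchedule) {N₀ N₀' : ℕ → ℕ} (la lb kl bl : ℕ → ℕ) (σ : K →+* K) (ϖ : K) {d t : ℕ} (hle : N₀ d ≤ N₀' d)
    (h : LevKappaSignLawAtS2 shift Ω N₀ la lb kl bl σ ϖ d t) : LevKappaSignLawAtS2 shift Ω N₀' la lb kl bl σ ϖ d t :=
  fun hD f hf δ hδ hδ0 a b ha hb ha1 hb1 n₁ n₂ n₃ hE Γ hΓ k hk i B hB =>
    h hD f hf δ hδ hδ0 a b ha hb ha1 hb1 n₁ n₂ n₃ (isElementDatum_of_le hle hE) Γ hΓ k hk i B hB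

end Reduction

/-- THRESHOLD WEAKENING · the T₊ law is ANTITONE in `N₀` at `d` (★ `isElementDatum_of_le`): a producer may prove it at any convenient threshold and (J) takes a deeper one. [cite: Rogawski1990, §4.9 Prop. 4.9.1 (a) p. 55] -/
theorem transvPlusKappaSignLawAtS2_of_le {K : Type} [Field K] [Valued K ℤᵐ⁰] [CompleteSpace K] [Fintype (Valued.ResidueField K)]
    (shift : ℕ → ℕ → ℤ) (Ω : OmegaSchedule) {N₀ N₀' : ℕ → ℕ} (A : ℕ → ℕ → ℕ → ℕ → ℤ → ℚ) (σ : K →+* K) (ϖ : K) {d t : ℕ} (hle : N₀ d ≤ N₀' d)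
    (h : TransvPlusKappaSignLawAtS2 shift Ω N₀ A σ ϖ d t) : TransvPlusKappaSignLawAtS2 shift Ω N₀' A σ ϖ d t :=
  fun hD f hf δ hδ hδ0 a b ha hb ha1 hb1 n₁ n₂ n₃ hE Γ hΓ k hk i B hB =>
    h hD f hf δ hδ hδ0 a b ha hb ha1 hb1 n₁ n₂ n₃ (isElementDatum_of_le hle hE) Γ hΓ k hk i B hB

/-! ## §2–§3  THE DERIVED ROAD (TEMPLATE-LAWS §2–§3; heir LEAD T19-31 (b) ∕ T19-32): (L-T+) ⇐ (L-lev)@m_c ×2 + (α′) + (β) — NO finiteness hypothesis -/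

section Derived

variable {K : Type} [Field K] [Valued K ℤᵐ⁰]

/-- Antitonicity in the level: `X·M ⊆ ϖ^{ℓ'}M ⇒ X·M ⊆ ϖ^ℓ M` for `ℓ ≤ ℓ'` (`|ϖ| ≤ 1`; ★ `scaleLattice_pow_antitone`). [cite: Rogawski1990, §4.9 Prop. 4.9.1 (a) p. 55] -/
theorem latticeInLevel_of_le {ϖ : K} (hϖ1 : Valued.v ϖ ≤ 1) {ℓ ℓ' : ℕ} (hle : ℓ ≤ ℓ') {X : Matrix (Fin 3) (Fin 3) K} {M : Submodule (Valued.integer K) (Fin 3 → K)}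
    (h : LatticeInLevel ϖ ℓ' X M) : LatticeInLevel ϖ ℓ X M :=
  h.trans (scaleLattice_pow_antitone hϖ1 M hle)

/-- **THE CLEAN SHELL SPLITS AS `T+ ⊔ T−′`** on a finite fixed type-0 set, GIVEN (α) at this literal and `m ≤ mc`:
`transvPlusFixCount (ℓ, m) + cleanMinusFixCount (ℓ, m, mc) = shellFixCount (ℓ, mc)`. [cite: Rogawski1990, §4.9 Prop. 4.9.1 (a) p. 55] -/
theorem transvPlusFixCount_add_cleanMinusFixCount_eq (σ : K →+* K) {ϖ : K} (hϖ1 : Valued.v ϖ ≤ 1) (d ℓ : ℕ) {m mc : ℕ} (hmc : m ≤ mc) (T : GL (Fin 3) K)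
    (hfin : {M : Submodule (Valued.integer K) (Fin 3 → K) | IsVertexLattice σ ϖ ((StdForm.antidiagonal 3).over K) 0 M ∧ mapGL T M = M}.Finite)
    (hα : ∀ M : Submodule (Valued.integer K) (Fin 3 → K), IsVertexLattice σ ϖ ((StdForm.antidiagonal 3).over K) 0 M → mapGL T M = M →
      LatticeNearTransvShell ϖ ℓ m ((T : Matrix (Fin 3) (Fin 3) K) - 1) M → LatticeLabelPlus σ ϖ d m M ((T : Matrix (Fin 3) (Fin 3) K) - 1) →
      LatticeInLevel ϖ mc (((T : Matrix (Fin 3) (Fin 3) K) - 1) * ((T : Matrix (Fin 3) (Fin 3) K) - 1)) M) :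
    transvPlusFixCount σ ϖ d ℓ m T + cleanMinusFixCount σ ϖ d ℓ m mc T = shellFixCount σ ϖ ℓ mc T := by
  -- the clean shell `C` and the label predicate `P`
  set C : Set (Submodule (Valued.integer K) (Fin 3 → K)) := {M | IsVertexLattice σ ϖ ((StdForm.antidiagonal 3).over K) 0 M ∧ mapGL T M = M ∧
      LatticeNearTransvShell ϖ ℓ mc ((T : Matrix (Fin 3) (Fin 3) K) - 1) M} with hC
  set P : Set (Submodule (Valued.integer K) (Fin 3 → K)) := {M | LatticeLabelPlus σ ϖ d m M ((T : Matrix (Fin 3) (Fin 3) K) - 1)} with hP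
  have hCfin : C.Finite := hfin.subset fun M hM => ⟨hM.1, hM.2.1⟩
  have h := Set.ncard_inter_add_ncard_sdiff_eq_ncard C P hCfin
  have h1 : C ∩ P = {M : Submodule (Valued.integer K) (Fin 3 → K) | IsVertexLattice σ ϖ ((StdForm.antidiagonal 3).over K) 0 M ∧ mapGL T M = M ∧
      LatticeNearTransvShell ϖ ℓ m ((T : Matrix (Fin 3) (Fin 3) K) - 1) M ∧ LatticeLabelPlus σ ϖ d m M ((T : Matrix (Fin 3) (Fin 3) K) - 1)} := by
    ext M
    simp only [hC, hP, Set.mem_inter_iff, Set.mem_setOf_eq, LatticeNearTransvShell]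
    constructor
    · rintro ⟨⟨h0, hT, hℓ, hℓ1, hmc'⟩, hL⟩
      exact ⟨h0, hT, ⟨hℓ, hℓ1, latticeInLevel_of_le hϖ1 hmc hmc'⟩, hL⟩
    · rintro ⟨h0, hT, ⟨hℓ, hℓ1, hm⟩, hL⟩
      exact ⟨⟨h0, hT, hℓ, hℓ1, hα M h0 hT ⟨hℓ, hℓ1, hm⟩ hL⟩, hL⟩
  have h2 : C \ P = {M : Submodule (Valued.integer K) (Fin 3 → K) | IsVertexLattice σ ϖ ((StdForm.antidiagonal 3).over K) 0 M ∧ mapGL T M = M ∧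
      LatticeNearTransvShell ϖ ℓ mc ((T : Matrix (Fin 3) (Fin 3) K) - 1) M ∧ ¬ LatticeLabelPlus σ ϖ d m M ((T : Matrix (Fin 3) (Fin 3) K) - 1)} := by
    ext M
    simp only [hC, hP, Set.mem_sdiff, Set.mem_setOf_eq, and_assoc]
  rw [h1, h2] at h
  rw [transvPlusFixCount, cleanMinusFixCount, shellFixCount]
  exact h

/-- TWICE THE `+`-COUNT ON THE CLEAN SHELL: `2·tP = shell(ℓ, mc) + (tP − T−′)` (given (α) at the literal and `m ≤ mc`). [cite: Rogawski1990, §4.9 Prop. 4.9.1 (a) p. 55] -/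
theorem two_mul_transvPlusFixCount_eq_clean (σ : K →+* K) {ϖ : K} (hϖ1 : Valued.v ϖ ≤ 1) (d ℓ : ℕ) {m mc : ℕ} (hmc : m ≤ mc) (T : GL (Fin 3) K)
    (hfin : {M : Submodule (Valued.integer K) (Fin 3 → K) | IsVertexLattice σ ϖ ((StdForm.antidiagonal 3).over K) 0 M ∧ mapGL T M = M}.Finite)
    (hα : ∀ M : Submodule (Valued.integer K) (Fin 3 → K), IsVertexLattice σ ϖ ((StdForm.antidiagonal 3).over K) 0 M → mapGL T M = M →
      LatticeNearTransvShell ϖ ℓ m ((T : Matrix (Fin 3) (Fin 3) K) - 1) M → LatticeLabelPlus σ ϖ d m M ((T : Matrix (Fin 3) (Fin 3) K) - 1) →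
      LatticeInLevel ϖ mc (((T : Matrix (Fin 3) (Fin 3) K) - 1) * ((T : Matrix (Fin 3) (Fin 3) K) - 1)) M) :
    2 * (transvPlusFixCount σ ϖ d ℓ m T : ℤ) =
      (shellFixCount σ ϖ ℓ mc T : ℤ) + ((transvPlusFixCount σ ϖ d ℓ m T : ℤ) - (cleanMinusFixCount σ ϖ d ℓ m mc T : ℤ)) := by
  rw [← transvPlusFixCount_add_cleanMinusFixCount_eq σ hϖ1 d ℓ hmc T hfin hα, Nat.cast_add]; ring

/-- THE κ-SUM OF `T+` IS HALF THE κ-SUM OF THE CLEAN SHELL when `T+ − T−′` is frame-constant ((β); the constant dies by `Σ_b κ_i(b) = 0`). [cite: Rogawski1990, §4.9 Prop. 4.9.1 (a) p. 55] -/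
theorem two_mul_kappaSum_transvPlusFixCount_eq_clean (σ : K →+* K) {ϖ : K} (hϖ1 : Valued.v ϖ ≤ 1) (d ℓ : ℕ) {m mc : ℕ} (hmc : m ≤ mc) (Γ : Fin 4 → GL (Fin 3) K)
    (hfin : ∀ b, {M : Submodule (Valued.integer K) (Fin 3 → K) | IsVertexLattice σ ϖ ((StdForm.antidiagonal 3).over K) 0 M ∧ mapGL (Γ b) M = M}.Finite)
    (hα : ∀ (b : Fin 4) (M : Submodule (Valued.integer K) (Fin 3 → K)), IsVertexLattice σ ϖ ((StdForm.antidiagonal 3).over K) 0 M → mapGL (Γ b) M = M →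
      LatticeNearTransvShell ϖ ℓ m ((Γ b : Matrix (Fin 3) (Fin 3) K) - 1) M → LatticeLabelPlus σ ϖ d m M ((Γ b : Matrix (Fin 3) (Fin 3) K) - 1) →
      LatticeInLevel ϖ mc (((Γ b : Matrix (Fin 3) (Fin 3) K) - 1) * ((Γ b : Matrix (Fin 3) (Fin 3) K) - 1)) M)
    (c : ℤ) (hβ : ∀ b, (transvPlusFixCount σ ϖ d ℓ m (Γ b) : ℤ) - (cleanMinusFixCount σ ϖ d ℓ m mc (Γ b) : ℤ) = c) (i : Fin 3) :
    2 * (∑ b : Fin 4, kappaChar i b * (transvPlusFixCount σ ϖ d ℓ m (Γ b) : ℤ)) = ∑ b : Fin 4, kappaChar i b * (shellFixCount σ ϖ ℓ mc (Γ b) : ℤ) := by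
  have key : ∀ b : Fin 4, 2 * (kappaChar i b * (transvPlusFixCount σ ϖ d ℓ m (Γ b) : ℤ)) =
      kappaChar i b * (shellFixCount σ ϖ ℓ mc (Γ b) : ℤ) + c * kappaChar i b := by
    intro b
    rw [mul_left_comm, two_mul_transvPlusFixCount_eq_clean σ hϖ1 d ℓ hmc (Γ b) (hfin b) (hα b), hβ b]; ring
  rw [Finset.mul_sum, Finset.sum_congr rfl fun b _ => key b, Finset.sum_add_distrib, ← Finset.mul_sum, sum_kappaChar_eq_zero, mul_zero, add_zero]

/-- **THE DERIVED REDUCTION AT ONE DATUM** — (L-T+) ⇐ F0P3a-p01's (L-lev) at the CLEAN square level (lower `(laLowOfRecord, mc, k₁, b₁)`, upper `(laHighOfRecord, mc, k₂, b₂)`) + (α) + (β),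
all at a common threshold `N₀`, schedule-generic in `mc` (needs `m* ≤ mc d`): output letter `amplHalfDiff (amplShift k₁ b₁) (amplShift k₂ b₂)` — at the memo's
`(k₁, b₁, k₂, b₂) = (s, s, s+1, s−1)`, `mc := mcOfRecord`, this is `amplTransvPlusDerived` (`rfl`).  NO finiteness hypothesis (`finite_fixed_typeZero_frameElt`). [cite: Rogawski1990, §4.9 Prop. 4.9.1 (a) p. 55] -/
theorem transvPlusKappaSignLawAtS2_of_levClean_of_labelClean_of_cleanSgn {K : Type} [Field K] [Valued K ℤᵐ⁰] [CompleteSpace K] [Fintype (Valued.ResidueField K)]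
    (shift : ℕ → ℕ → ℤ) (Ω : OmegaSchedule) (N₀ mc k₁ b₁ k₂ b₂ : ℕ → ℕ) (σ : K →+* K) (ϖ : K) (d t : ℕ) (hmc : mstarOfRecord d ≤ mc d)
    (hlow : LevKappaSignLawAtS2 shift Ω N₀ laLowOfRecord mc k₁ b₁ σ ϖ d t) (hhigh : LevKappaSignLawAtS2 shift Ω N₀ laHighOfRecord mc k₂ b₂ σ ϖ d t)
    (hα : LabelPlusCleanLawAt N₀ mc σ ϖ d t) (hβ : CleanSgnFrameConstLawAt N₀ mc σ ϖ d t) :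
    TransvPlusKappaSignLawAtS2 shift Ω N₀ (amplHalfDiff (amplShift k₁ b₁) (amplShift k₂ b₂)) σ ϖ d t := by
  intro hD f hf δ hδ hδ0 a b ha hb ha1 hb1 n₁ n₂ n₃ hE Γ hΓ k hk i B hB
  obtain ⟨-, -, hvϖ, -⟩ := id hD
  have hϖ1 : Valued.v ϖ ≤ 1 := by rw [hvϖ, ← WithZero.exp_zero, WithZero.exp_le_exp]; omega
  obtain ⟨c, hc⟩ := hβ hD f hf (a * a) (b * b) n₁ n₂ n₃ hE Γ hΓ
  have hfin := finite_fixed_typeZero_frameElt hD hf hE hΓ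
  have h2 := congrArg (fun z : ℤ => (z : ℚ))
    (two_mul_kappaSum_transvPlusFixCount_eq_clean σ hϖ1 d (d % 2) hmc Γ hfin (fun b' => hα hD f hf (a * a) (b * b) n₁ n₂ n₃ hE Γ hΓ b') c hc i)
  have hS := kappaSum_shellFixCount_eq_of_low_of_high σ hϖ1 (d % 2) (mc d) Γ hfin i _ _ _
    (hlow hD f hf δ hδ hδ0 a b ha hb ha1 hb1 n₁ n₂ n₃ hE Γ hΓ k hk i B hB) (hhigh hD f hf δ hδ hδ0 a b ha hb ha1 hb1 n₁ n₂ n₃ hE Γ hΓ k hk i B hB)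
  simp only [Int.cast_mul, Int.cast_ofNat] at h2
  rw [hS] at h2
  rw [amplHalfDiff, amplShift, amplShift]
  linarith

/-- **THE DERIVED TARGET FROM ITS FOUR INGREDIENTS AT THE RECORD** — `TransvPlusLawTargetDerived N₀T` ⟸ the fenced (L-lev) laws at the clean square level `mcOfRecord` with the memo's
exponents `(sT, sT)` ∕ `(sT+1, sT−1)`, (α) and (β), all at `N₀T` (each antitone in its threshold, so producers may prove them shallower). [cite: Rogawski1990, §4.9 Prop. 4.9.1 (a) p. 55] -/
theorem transvPlusLawTargetDerived_of (N₀T : ℕ → ℕ)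
    (hlow : ∀ {K : Type} [Field K] [Valued K ℤᵐ⁰] [CompleteSpace K] [Fintype (Valued.ResidueField K)] (σ : K →+* K) (ϖ : K) (d t : ℕ),
      DyadicFence (K := K) (LevKappaSignLawAtS2 shiftR omegaR N₀T laLowOfRecord mcOfRecord sTOfRecord sTOfRecord σ ϖ d t))
    (hhigh : ∀ {K : Type} [Field K] [Valued K ℤᵐ⁰] [CompleteSpace K] [Fintype (Valued.ResidueField K)] (σ : K →+* K) (ϖ : K) (d t : ℕ),
      DyadicFence (K := K) (LevKappaSignLawAtS2 shiftR omegaR N₀T laHighOfRecord mcOfRecord (fun d => sTOfRecord d + 1) (fun d => sTOfRecord d - 1) σ ϖ d t))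
    (hα : ∀ {K : Type} [Field K] [Valued K ℤᵐ⁰] [CompleteSpace K] [Fintype (Valued.ResidueField K)] (σ : K →+* K) (ϖ : K) (d t : ℕ),
      DyadicFence (K := K) (LabelPlusCleanLawAt N₀T mcOfRecord σ ϖ d t))
    (hβ : ∀ {K : Type} [Field K] [Valued K ℤᵐ⁰] [CompleteSpace K] [Fintype (Valued.ResidueField K)] (σ : K →+* K) (ϖ : K) (d t : ℕ),
      DyadicFence (K := K) (CleanSgnFrameConstLawAt N₀T mcOfRecord σ ϖ d t)) :
    TransvPlusLawTargetDerived N₀T := fun σ ϖ d t h2 =>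
  transvPlusKappaSignLawAtS2_of_levClean_of_labelClean_of_cleanSgn shiftR omegaR N₀T mcOfRecord sTOfRecord sTOfRecord
    (fun d => sTOfRecord d + 1) (fun d => sTOfRecord d - 1) σ ϖ d t (mstarOfRecord_le_mcOfRecord d)
    (hlow σ ϖ d t h2) (hhigh σ ϖ d t h2) (hα σ ϖ d t h2) (hβ σ ϖ d t h2)

end Derived

/-! ## §4  THE (J) JUNCTION AT `j = 1` (★ p858707 ∕ ★ p858837 lineage; twin of ★ p859064 from the law side): the law read at the socket, and law + (H-T+)′ ⟹ the row type -/

/-- `gselStar 1 = pieceTransvPlus` — `rfl`. [cite: Rogawski1990, §4.9 Prop. 4.9.1 (a) p. 55] -/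
theorem gselStar_one : gselStar 1 = pieceTransvPlus := rfl

/-- `cntStar 1 = cntTransvPlus` — `rfl`. [cite: Rogawski1990, §4.9 Prop. 4.9.1 (a) p. 55] -/
theorem cntStar_one : cntStar 1 = cntTransvPlus := rfl

/-- U2G's ★ dictionary of `f_{T+}` in the socket's letters: `PieceCountDictionary (gselStar 1) (cntStar 1)`. [cite: Rogawski1990, §4.9 Prop. 4.9.1 (a) p. 55] -/
theorem pieceCountDictionary_gselStar_one : PieceCountDictionary (gselStar 1) (cntStar 1) := pieceCountDictionary_transvPlus

/-- AT A PLACE WITH DATUM `d`, THE SOCKET's COUNT IS THE LAW's COUNT: `cntStar 1 L v w hw ϖ T = transvPlusFixCount σ_w ϖ d (d % 2) (mstarOfRecord d) T` (★ `dOfPlace = d`). [cite: Rogawski1990, §4.9 Prop. 4.9.1 (a) p. 55] -/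
theorem cntStar_one_apply_eq (L : Type) [Field L] [NumberField L] [IsCMField L] {v : HeightOneSpectrum (𝓞 ↥(maximalRealSubfield L))}
    (w : UnitaryGroup.PlacesOver L v) (hw : IsCMField.complexConj L • w.1 = w.1) (he : v.asIdeal.ramificationIdx' w.1.asIdeal ≠ 1)
    {ϖ : w.1.adicCompletion L} {d tE : ℕ} (hD : IsRamifiedQuadraticDatum (galAdicCompletionMap (L := L) (IsCMField.complexConj L) hw) ϖ d tE)
    (T : GL (Fin 3) (w.1.adicCompletion L)) :
    cntStar 1 L v w hw ϖ T = transvPlusFixCount (galAdicCompletionMap (L := L) (IsCMField.complexConj L) hw) ϖ d (d % 2) (mstarOfRecord d) T := by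
  rw [cntStar_one, cntTransvPlus, mstarFn, dOfPlace_eq_of_isRamifiedQuadraticDatum L w hw he hD]

/-- **THE LAW READ AT THE SOCKET**: at a wild place with datum `(d, t_E)`, (K-SGN-T+)-S2-At gives the (J) socket's frame census `Σ_b κ_i(b)·cntStar 1 (Γ_b)` IN ℂ as
`sign · token` — the exact right-hand side the (H-T+) producer (LH4-p14 (g6)) must realise times `Δ‴(γ_H, t_{b₀})·νG₃(K)`. [cite: Rogawski1990, §4.9 Prop. 4.9.1 (a) p. 55] -/
theorem sum_kappaChar_mul_cntStar_one_eq (shift : ℕ → ℕ → ℤ) (Ω : OmegaSchedule) (N₀ : ℕ → ℕ) (A : ℕ → ℕ → ℕ → ℕ → ℤ → ℚ)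
    (L : Type) [Field L] [NumberField L] [IsCMField L] {v : HeightOneSpectrum (𝓞 ↥(maximalRealSubfield L))}
    (w : UnitaryGroup.PlacesOver L v) (hw : IsCMField.complexConj L • w.1 = w.1) (he : v.asIdeal.ramificationIdx' w.1.asIdeal ≠ 1)
    [Fintype (Valued.ResidueField (w.1.adicCompletion L))]
    {ϖ : w.1.adicCompletion L} {d tE : ℕ} (hD : IsRamifiedQuadraticDatum (galAdicCompletionMap (L := L) (IsCMField.complexConj L) hw) ϖ d tE)
    (hlaw : TransvPlusKappaSignLawAtS2 shift Ω N₀ A (galAdicCompletionMap (L := L) (IsCMField.complexConj L) hw) ϖ d tE)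
    (f : Fin 4 → Fin 3 → (Fin 3 → (w.1.adicCompletion L))) (hf : IsFourFrameFamily (galAdicCompletionMap (L := L) (IsCMField.complexConj L) hw) f)
    (δ : w.1.adicCompletion L) (hδ : (galAdicCompletionMap (L := L) (IsCMField.complexConj L) hw) δ = -δ) (hδ0 : δ ≠ 0)
    (a b : w.1.adicCompletion L) (ha : a * (galAdicCompletionMap (L := L) (IsCMField.complexConj L) hw) a = 1) (hb : b * (galAdicCompletionMap (L := L) (IsCMField.complexConj L) hw) b = 1)
    (ha1 : Valued.v (a - 1) < Valued.v (2 : (w.1.adicCompletion L))) (hb1 : Valued.v (b - 1) < Valued.v (2 : (w.1.adicCompletion L)))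
    (n₁ n₂ n₃ : ℕ) (hE : IsElementDatum (galAdicCompletionMap (L := L) (IsCMField.complexConj L) hw) ϖ (N₀ d) (a * a) (b * b) n₁ n₂ n₃)
    (Γ : Fin 4 → GL (Fin 3) (w.1.adicCompletion L)) (hΓ : ∀ b', (Γ b' : Matrix (Fin 3) (Fin 3) (w.1.adicCompletion L)) = frameElt (galAdicCompletionMap (L := L) (IsCMField.complexConj L) hw) f b' (a * a) (b * b))
    (k : ℕ) (hk : 2 * k + d = n₁ + n₂ + n₃ + 2)
    (i : Fin 3) (B : ℤ) (hB : 2 * B = ((![n₁, n₂, n₃] : Fin 3 → ℕ) i : ℤ) - d + 2 - 2 * shift d tE) :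
    (∑ b' : Fin 4, (kappaChar i b' : ℂ) * (cntStar 1 L v w hw ϖ (Γ b') : ℂ)) =
      ((Ω (w.1.adicCompletion L) (galAdicCompletionMap (L := L) (IsCMField.complexConj L) hw) ϖ d a b i * (baseSign (galAdicCompletionMap (L := L) (IsCMField.complexConj L) hw) i * normSign (galAdicCompletionMap (L := L) (IsCMField.complexConj L) hw) (fPartProd δ ![a, b, 1] i)) : ℤ) : ℂ) *
        ((A (Fintype.card (Valued.ResidueField (w.1.adicCompletion L))) d tE k B : ℚ) : ℂ) := by
  have h0 := hlaw hD f hf δ hδ hδ0 a b ha hb ha1 hb1 n₁ n₂ n₃ hE Γ hΓ k hk i B hB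
  simp only [cntStar_one_apply_eq L w hw he hD]
  have h' := congrArg (fun x : ℚ => (x : ℂ)) h0
  push_cast at h' ⊢
  exact h'

/-- **THE (J) JUNCTION AT `j = 1` — BOTH SHEETS PLUG INTO ONE (J) CALL.**  GIVEN the (L-T+) law at every complete datum behind the dyadic fence (the §2 target, any schedules)
AND an (H-T+) triple whose ROW (1) realises `Δ‴(γ_H, t_{b₀}) · νG₃(K) · (sign · token)` in the SAME letters (LH4-p14 (g6)'s (H-T+)-SIG; rows (2)(3) = the piece's type-(2) ∕ Levi
rows as in ★ p858837), THEN `PieceRowsWild gselStar 1` — ★ p858837 at `j = 1` with U2G's ★ dictionary, ★ (D-CΔ)-S at any schedule, and §4's reading of the law at the socket.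
This is the tier-0 pay-line shape for `stub_rows_transvPlus` (never written here). [cite: Rogawski1990, §4.9 Prop. 4.9.1 (a) p. 55] -/
theorem pieceRowsWild_gselStar_one_of_law_of_hside (shift : ℕ → ℕ → ℤ) (Ω : OmegaSchedule) (N₀ : ℕ → ℕ) (A : ℕ → ℕ → ℕ → ℕ → ℤ → ℚ)
    (hL : ∀ {K : Type} [Field K] [Valued K ℤᵐ⁰] [CompleteSpace K] [Fintype (Valued.ResidueField K)] (σ : K →+* K) (ϖ : K) (d t : ℕ),
      DyadicFence (K := K) (TransvPlusKappaSignLawAtS2 shift Ω N₀ A σ ϖ d t))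
    (hH :
      ∀ (L : Type) [Field L] [NumberField L] [IsCMField L]
        {v : HeightOneSpectrum (𝓞 ↥(maximalRealSubfield L))} (w : UnitaryGroup.PlacesOver L v)
        (hw : IsCMField.complexConj L • w.1 = w.1) (_he : v.asIdeal.ramificationIdx' w.1.asIdeal ≠ 1)
        (_h2 : ¬ IsUnit (2 : 𝒪[w.1.adicCompletion L]))
        (ϖ : (w.1.adicCompletion L)) (_hϖ : Valued.v ϖ = WithZero.exp (-1 : ℤ)) (d tE : ℕ) (_hD : IsRamifiedQuadraticDatum (galAdicCompletionMap (L := L) (IsCMField.complexConj L) hw) ϖ d tE)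
        [Fintype (Valued.ResidueField (w.1.adicCompletion L))] (δ : (w.1.adicCompletion L)) (_hδ : (galAdicCompletionMap (L := L) (IsCMField.complexConj L) hw) δ = -δ) (_hδ0 : δ ≠ 0)
        (μ : HeckeCharacter L) (_hμu : μ.IsUnitary)
        (_hμω : ∀ x : ideleGroup ↥(maximalRealSubfield L), μ (AdeleRing.ideleBaseChange ↥(maximalRealSubfield L) L x) = quadraticHeckeCharCM L x)
        [MeasurableSpace ((UnitaryGroup.cmDatum L 3 (Matrix.of fun i j : Fin 3 => if i.val + j.val + 1 = 3 then (1 : L) else 0)).Local v)] [BorelSpace ((UnitaryGroup.cmDatum L 3 (Matrix.of fun i j : Fin 3 => if i.val + j.val + 1 = 3 then (1 : L) else 0)).Local v)]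
        [∀ γ : ((UnitaryGroup.cmDatum L 3 (Matrix.of fun i j : Fin 3 => if i.val + j.val + 1 = 3 then (1 : L) else 0)).Local v), MeasurableSpace (((UnitaryGroup.cmDatum L 3 (Matrix.of fun i j : Fin 3 => if i.val + j.val + 1 = 3 then (1 : L) else 0)).Local v) ⧸ Subgroup.centralizer ({γ} : Set ((UnitaryGroup.cmDatum L 3 (Matrix.of fun i j : Fin 3 => if i.val + j.val + 1 = 3 then (1 : L) else 0)).Local v)))]
        [∀ γ : ((UnitaryGroup.cmDatum L 3 (Matrix.of fun i j : Fin 3 => if i.val + j.val + 1 = 3 then (1 : L) else 0)).Local v), BorelSpace (((UnitaryGroup.cmDatum L 3 (Matrix.of fun i j : Fin 3 => if i.val + j.val + 1 = 3 then (1 : L) else 0)).Local v) ⧸ Subgroup.centralizer ({γ} : Set ((UnitaryGroup.cmDatum L 3 (Matrix.of fun i j : Fin 3 => if i.val + j.val + 1 = 3 then (1 : L) else 0)).Local v)))]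
        [MeasurableSpace ((UnitaryGroup.cmDatum L 2 (Matrix.of fun i j : Fin 2 => if i.val + j.val + 1 = 2 then (1 : L) else 0)).Local v × (UnitaryGroup.cmDatum L 1 (Matrix.of fun i j : Fin 1 => if i.val + j.val + 1 = 1 then (1 : L) else 0)).Local v)] [BorelSpace ((UnitaryGroup.cmDatum L 2 (Matrix.of fun i j : Fin 2 => if i.val + j.val + 1 = 2 then (1 : L) else 0)).Local v × (UnitaryGroup.cmDatum L 1 (Matrix.of fun i j : Fin 1 => if i.val + j.val + 1 = 1 then (1 : L) else 0)).Local v)]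
        [∀ a : ((UnitaryGroup.cmDatum L 2 (Matrix.of fun i j : Fin 2 => if i.val + j.val + 1 = 2 then (1 : L) else 0)).Local v × (UnitaryGroup.cmDatum L 1 (Matrix.of fun i j : Fin 1 => if i.val + j.val + 1 = 1 then (1 : L) else 0)).Local v), MeasurableSpace (((UnitaryGroup.cmDatum L 2 (Matrix.of fun i j : Fin 2 => if i.val + j.val + 1 = 2 then (1 : L) else 0)).Local v × (UnitaryGroup.cmDatum L 1 (Matrix.of fun i j : Fin 1 => if i.val + j.val + 1 = 1 then (1 : L) else 0)).Local v) ⧸ Subgroup.centralizer ({a} : Set ((UnitaryGroup.cmDatum L 2 (Matrix.of fun i j : Fin 2 => if i.val + j.val + 1 = 2 then (1 : L) else 0)).Local v × (UnitaryGroup.cmDatum L 1 (Matrix.of fun i j : Fin 1 => if i.val + j.val + 1 = 1 then (1 : L) else 0)).Local v)))]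
        [∀ a : ((UnitaryGroup.cmDatum L 2 (Matrix.of fun i j : Fin 2 => if i.val + j.val + 1 = 2 then (1 : L) else 0)).Local v × (UnitaryGroup.cmDatum L 1 (Matrix.of fun i j : Fin 1 => if i.val + j.val + 1 = 1 then (1 : L) else 0)).Local v), BorelSpace (((UnitaryGroup.cmDatum L 2 (Matrix.of fun i j : Fin 2 => if i.val + j.val + 1 = 2 then (1 : L) else 0)).Local v × (UnitaryGroup.cmDatum L 1 (Matrix.of fun i j : Fin 1 => if i.val + j.val + 1 = 1 then (1 : L) else 0)).Local v) ⧸ Subgroup.centralizer ({a} : Set ((UnitaryGroup.cmDatum L 2 (Matrix.of fun i j : Fin 2 => if i.val + j.val + 1 = 2 then (1 : L) else 0)).Local v × (UnitaryGroup.cmDatum L 1 (Matrix.of fun i j : Fin 1 => if i.val + j.val + 1 = 1 then (1 : L) else 0)).Local v)))]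
        (νH : Measure ((UnitaryGroup.cmDatum L 2 (Matrix.of fun i j : Fin 2 => if i.val + j.val + 1 = 2 then (1 : L) else 0)).Local v × (UnitaryGroup.cmDatum L 1 (Matrix.of fun i j : Fin 1 => if i.val + j.val + 1 = 1 then (1 : L) else 0)).Local v)) [νH.IsHaarMeasure] [νH.IsMulRightInvariant]
        (νG₃ : Measure ((UnitaryGroup.cmDatum L 3 (Matrix.of fun i j : Fin 3 => if i.val + j.val + 1 = 3 then (1 : L) else 0)).Local v)) [νG₃.IsHaarMeasure] [νG₃.IsMulRightInvariant]
        (mH : OrbitalMeasureFamily ((UnitaryGroup.cmDatum L 2 (Matrix.of fun i j : Fin 2 => if i.val + j.val + 1 = 2 then (1 : L) else 0)).Local v × (UnitaryGroup.cmDatum L 1 (Matrix.of fun i j : Fin 1 => if i.val + j.val + 1 = 1 then (1 : L) else 0)).Local v)) (mG₃ : OrbitalMeasureFamily ((UnitaryGroup.cmDatum L 3 (Matrix.of fun i j : Fin 3 => if i.val + j.val + 1 = 3 then (1 : L) else 0)).Local v))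
        (_hmH : mH.IsCanonical (IsLocalGRegular L v) νH) (_hmG : mG₃.IsCanonical (fun γ => IsRegularElt (γ.val : GL (Fin 3) (UnitaryGroup.LocalRing L v))) νG₃),
        ∃ (r : ℕ) (ψ : Fin r → ((UnitaryGroup.cmDatum L 2 (Matrix.of fun i j : Fin 2 => if i.val + j.val + 1 = 2 then (1 : L) else 0)).Local v × (UnitaryGroup.cmDatum L 1 (Matrix.of fun i j : Fin 1 => if i.val + j.val + 1 = 1 then (1 : L) else 0)).Local v) → ℂ) (_ : ∀ s, IsLocSmooth (ψ s)) (coef : Fin r → ℂ),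
          -- ROW (1): the H-side realises THE κ-SIGNED CENSUS OF THE PIECE OVER THE FOUR FRAMES `Γ_b` times the base transfer factor (no law pre-evaluated)
          (∃ V ∈ 𝓝 (1 : ((UnitaryGroup.cmDatum L 2 (Matrix.of fun i j : Fin 2 => if i.val + j.val + 1 = 2 then (1 : L) else 0)).Local v × (UnitaryGroup.cmDatum L 1 (Matrix.of fun i j : Fin 1 => if i.val + j.val + 1 = 1 then (1 : L) else 0)).Local v)), ∀ γH ∈ V, IsLocalGRegular L v γH →
            ∀ (f : Fin 4 → Fin 3 → (Fin 3 → (w.1.adicCompletion L))) (_hf : IsFourFrameFamily (galAdicCompletionMap (L := L) (IsCMField.complexConj L) hw) f)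
          (a b z : (w.1.adicCompletion L)) (_ha : a * (galAdicCompletionMap (L := L) (IsCMField.complexConj L) hw) a = 1) (_hb : b * (galAdicCompletionMap (L := L) (IsCMField.complexConj L) hw) b = 1) (_hz : z * (galAdicCompletionMap (L := L) (IsCMField.complexConj L) hw) z = 1)
          (_hzγ : z = finGammaTwo L v γH w) (_hra : ((((γH).1.val : GL (Fin 2) (UnitaryGroup.LocalRing L v)).val.map (Pi.evalRingHom (fun w' : UnitaryGroup.PlacesOver L v => w'.1.adicCompletion L) w))).charpoly.IsRoot (z * (a * a))) (_hrb : ((((γH).1.val : GL (Fin 2) (UnitaryGroup.LocalRing L v)).val.map (Pi.evalRingHom (fun w' : UnitaryGroup.PlacesOver L v => w'.1.adicCompletion L) w))).charpoly.IsRoot (z * (b * b)))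
          (_ha1 : Valued.v (a - 1) < Valued.v (2 : (w.1.adicCompletion L))) (_hb1 : Valued.v (b - 1) < Valued.v (2 : (w.1.adicCompletion L)))
          (n₁ n₂ n₃ : ℕ) (_hE : IsElementDatum (galAdicCompletionMap (L := L) (IsCMField.complexConj L) hw) ϖ (N₀ d) (a * a) (b * b) n₁ n₂ n₃)
          (k : ℕ) (_hk : 2 * k + d = n₁ + n₂ + n₃ + 2)
          (Γ : Fin 4 → GL (Fin 3) (w.1.adicCompletion L)) (_hΓ : ∀ b', (Γ b' : Matrix (Fin 3) (Fin 3) (w.1.adicCompletion L)) = frameElt (galAdicCompletionMap (L := L) (IsCMField.complexConj L) hw) f b' (a * a) (b * b))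
          (tb : Fin 4 → ((UnitaryGroup.cmDatum L 3 (Matrix.of fun i j : Fin 3 => if i.val + j.val + 1 = 3 then (1 : L) else 0)).Local v)) (_htb : ∀ b', ((((localNonsplitEquiv (IsCMField.complexConj L) (Matrix.of fun i j : Fin 3 => if i.val + j.val + 1 = 3 then (1 : L) else 0) (IsCMField.complexConj_ne_one L) w hw (tb b') :
                ↥(unitaryGroupOfForm (galAdicCompletionMap (L := L) (IsCMField.complexConj L) hw) (placeForm (Matrix.of fun i j : Fin 3 => if i.val + j.val + 1 = 3 then (1 : L) else 0) w.1))) : GL (Fin 3) (w.1.adicCompletion L)) : Matrix (Fin 3) (Fin 3) (w.1.adicCompletion L))) = z • (Γ b' : Matrix (Fin 3) (Fin 3) (w.1.adicCompletion L)))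
              (i : Fin 3) (B : ℤ), 2 * B = ((![n₁, n₂, n₃] : Fin 3 → ℕ) i : ℤ) - d + 2 - 2 * shift d tE →
              (∀ t' : ((UnitaryGroup.cmDatum L 3 (Matrix.of fun i j : Fin 3 => if i.val + j.val + 1 = 3 then (1 : L) else 0)).Local v), IsLocalNormPair L (Matrix.of fun i j : Fin 3 => if i.val + j.val + 1 = 3 then (1 : L) else 0) v γH t' ↔ ∃ b', ConjClasses.mk t' = ConjClasses.mk (tb b')) →
              (∀ b' : Fin 4, ((finExplicitCollection L (Matrix.of fun i j : Fin 3 => if i.val + j.val + 1 = 3 then (1 : L) else 0) μ (finExplicitDelta_conj_left_all L (Matrix.of fun i j : Fin 3 => if i.val + j.val + 1 = 3 then (1 : L) else 0) μ) (finExplicitDelta_conj_right_all L (Matrix.of fun i j : Fin 3 => if i.val + j.val + 1 = 3 then (1 : L) else 0) μ)) v).Δ γH (tb b') = ((finExplicitCollection L (Matrix.of fun i j : Fin 3 => if i.val + j.val + 1 = 3 then (1 : L) else 0) μ (finExplicitDelta_conj_left_all L (Matrix.of fun i j : Fin 3 => if i.val + j.val + 1 = 3 then (1 : L) else 0) μ)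 (finExplicitDelta_conj_right_all L (Matrix.of fun i j : Fin 3 => if i.val + j.val + 1 = 3 then (1 : L) else 0) μ)) v).Δ γH (tb 0) * (kappaChar i b' : ℂ)) →
              ∑ s, coef s * stableOrbitalIntegralRel (IsLocalStablyConjH L v) mH (ψ s) γH =
                ((finExplicitCollection L (Matrix.of fun i j : Fin 3 => if i.val + j.val + 1 = 3 then (1 : L) else 0) μ (finExplicitDelta_conj_left_all L (Matrix.of fun i j : Fin 3 => if i.val + j.val + 1 = 3 then (1 : L) else 0) μ) (finExplicitDelta_conj_right_all L (Matrix.of fun i j : Fin 3 => if i.val + j.val + 1 = 3 then (1 : L) else 0) μ)) v).Δ γH (tb 0) * ((νG₃ (cmLocalIntegralLevel L 3 (Matrix.of fun i j : Fin 3 => if i.val + j.val + 1 = 3 then (1 : L) else 0) v : Set ((UnitaryGroup.cmDatum L 3 (Matrix.of fun i j : Fin 3 => if i.val + j.val + 1 = 3 then (1 : L) else 0)).Local v))).toReal : ℂ) *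
                  (((Ω (w.1.adicCompletion L) (galAdicCompletionMap (L := L) (IsCMField.complexConj L) hw) ϖ d a b i * (baseSign (galAdicCompletionMap (L := L) (IsCMField.complexConj L) hw) i * normSign (galAdicCompletionMap (L := L) (IsCMField.complexConj L) hw) (fPartProd δ ![a, b, 1] i)) : ℤ) : ℂ) * ((A (Fintype.card (Valued.ResidueField (w.1.adicCompletion L))) d tE k B : ℚ) : ℂ))) ∧
          -- ROW (2), type (2), transfer-shaped (law debt)
          (∃ V ∈ 𝓝 (1 : ((UnitaryGroup.cmDatum L 2 (Matrix.of fun i j : Fin 2 => if i.val + j.val + 1 = 2 then (1 : L) else 0)).Local v × (UnitaryGroup.cmDatum L 1 (Matrix.of fun i j : Fin 1 => if i.val + j.val + 1 = 1 then (1 : L) else 0)).Local v)), ∀ γH ∈ V, IsLocalGRegular L v γH →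
          ¬ (∃ x : (w.1.adicCompletion L), (((((γH).1.val : GL (Fin 2) (UnitaryGroup.LocalRing L v)).val.map (Pi.evalRingHom (fun w' : UnitaryGroup.PlacesOver L v => w'.1.adicCompletion L) w))).charpoly).IsRoot x) →
          ∑ᶠ c : ConjClasses ((UnitaryGroup.cmDatum L 3 (Matrix.of fun i j : Fin 3 => if i.val + j.val + 1 = 3 then (1 : L) else 0)).Local v), ((finExplicitCollection L (Matrix.of fun i j : Fin 3 => if i.val + j.val + 1 = 3 then (1 : L) else 0) μ (finExplicitDelta_conj_left_all L (Matrix.of fun i j : Fin 3 => if i.val + j.val + 1 = 3 then (1 : L) else 0) μ) (finExplicitDelta_conj_right_all L (Matrix.of fun i j : Fin 3 => if i.val + j.val + 1 = 3 then (1 : L) else 0) μ)) v).Δ γH (Quotient.out c) * classOrbitalIntegral mG₃ ((gselStar 1) L v w hw ϖ) c =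
            ∑ s, coef s * stableOrbitalIntegralRel (IsLocalStablyConjH L v) mH (ψ s) γH) ∧
          -- ROW (3), Levi, transfer-shaped (law debt)
          (∃ V ∈ 𝓝 (1 : ((UnitaryGroup.cmDatum L 2 (Matrix.of fun i j : Fin 2 => if i.val + j.val + 1 = 2 then (1 : L) else 0)).Local v × (UnitaryGroup.cmDatum L 1 (Matrix.of fun i j : Fin 1 => if i.val + j.val + 1 = 1 then (1 : L) else 0)).Local v)), ∀ γH ∈ V, IsLocalGRegular L v γH →
          (∃ (y : ((UnitaryGroup.cmDatum L 2 (Matrix.of fun i j : Fin 2 => if i.val + j.val + 1 = 2 then (1 : L) else 0)).Local v × (UnitaryGroup.cmDatum L 1 (Matrix.of fun i j : Fin 1 => if i.val + j.val + 1 = 1 then (1 : L) else 0)).Local v)) (d' : Fin 2 → (UnitaryGroup.LocalRing L v)ˣ),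
              glDiagonal 2 (UnitaryGroup.LocalRing L v) d' = ((y * γH * y⁻¹).1.val : GL (Fin 2) (UnitaryGroup.LocalRing L v))) →
          ∑ᶠ c : ConjClasses ((UnitaryGroup.cmDatum L 3 (Matrix.of fun i j : Fin 3 => if i.val + j.val + 1 = 3 then (1 : L) else 0)).Local v), ((finExplicitCollection L (Matrix.of fun i j : Fin 3 => if i.val + j.val + 1 = 3 then (1 : L) else 0) μ (finExplicitDelta_conj_left_all L (Matrix.of fun i j : Fin 3 => if i.val + j.val + 1 = 3 then (1 : L) else 0) μ) (finExplicitDelta_conj_right_all L (Matrix.of fun i j : Fin 3 => if i.val + j.val + 1 = 3 then (1 : L) else 0) μ)) v).Δ γH (Quotient.out c) * classOrbitalIntegral mG₃ ((gselStar 1) L v w hw ϖ) c =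
            ∑ s, coef s * stableOrbitalIntegralRel (IsLocalStablyConjH L v) mH (ψ s) γH)) :
    PieceRowsWild gselStar 1 := by
  refine pieceRowsWild_gselStar_of_frameSignedCensus shift N₀ 1 pieceCountDictionary_gselStar_one (fourFrameTransferFactorS_any shift N₀) ?_
  intro L _i1 _i2 _i3 v w hw he h2 ϖ hϖ d tE hD _iF δ hδ hδ0 μ hμu hμω _i4 _i5 _i6 _i7 _i8 _i9 _i10 _i11 νH _i12 _i13 νG₃ _i14 _i15 mH mG₃ hmH hmG
  obtain ⟨r, ψ, hψ, coef, ⟨V, hV, h1⟩, hrow2, hrow3⟩ :=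
    hH L w hw he h2 ϖ hϖ d tE hD δ hδ hδ0 μ hμu hμω νH νG₃ mH mG₃ hmH hmG
  -- the dyadic fence at this wild place
  have hv2 : Valued.v (2 : w.1.adicCompletion L) < 1 :=
    v_two_lt_one_of_not_isUnit_two fun h => h2 (isUnit_two_valuationInteger_of_isUnit_two L w.1 h)
  have hlaw := hL (galAdicCompletionMap (L := L) (IsCMField.complexConj L) hw) ϖ d tE hv2
  refine ⟨r, ψ, hψ, coef, ⟨V, hV, ?_⟩, hrow2, hrow3⟩
  intro γH hγ hreg f hf a b z ha hb hz hzγ hra hrb ha1 hb1 n₁ n₂ n₃ hE k hk Γ hΓ tb htb i B hB hNP hrel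
  rw [h1 γH hγ hreg f hf a b z ha hb hz hzγ hra hrb ha1 hb1 n₁ n₂ n₃ hE k hk Γ hΓ tb htb i B hB hNP hrel,
    sum_kappaChar_mul_cntStar_one_eq shift Ω N₀ A L w hw he hD hlaw f hf δ hδ hδ0 a b ha hb ha1 hb1 n₁ n₂ n₃ hE Γ hΓ k hk i B hB]

end Summit.HodgeConjecture.HodgeConjecture.Cruxes.H413.F0P3cDyRamTransvPlusLawOfCleanLevels

end
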